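import Summits.CriticalPhenomena.PercolationContinuityZ3.Theses.PercNearOneGluing
import Summits.CriticalPhenomena.PercolationContinuityZ3.Theorems.PercNearOneGluingNoHeavyLowerTailReduction
import Summits.CriticalPhenomena.PercolationContinuityZ3.Theorems.PercNearOneGluingNoHeavyLowerTailFingerInductionDefs
import HarnessLib

/-!
# Crux `PercNearOneGluing.NoHeavyLowerTail` (stmt-CriticalPhenomena-4575), line `finger-induction` —
# the rungs of the induction on the number of fingers (all provable parts of the line)

Route-task `nh-b-induction` (prover-rtask-CriticalPhenomena-PercNearOneG-e949b7d1-0), 2026-08-17;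
lands with `--supports stmt-CriticalPhenomena-4575`.  Invariant: `FingerInv ε δ m`
(`Theorems/PercNearOneGluingNoHeavyLowerTailFingerInductionDefs.lean`) = Kozma–Nitzan's near-one gluing
(arXiv:2401.12397 Conjecture 3) in hub form at the finger levels `1 ≤ N' ≤ m`,
`N' = #{a ∈ A ∖ a₀ : o ↔ a}`, under the star budget `P(a ↮ a₀) ≤ δ` and the observer budget `P(o ↮ A) ≤ δ`.

## What is proved here (sorry-free)

* `fingerInv_one` — BASE `m = 1` with NO loss: `FingerInv δ δ 1` (the single-finger lemma, hub form:
  Kozma–Nitzan Lemma 2 with singleton blocks / van den Berg–Häggström–Kahn 2006 Thm 1.3, landed as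
  `nhlt_singleFingerHub`).
* `fingerInv_window`, `fingerInv_double` — the PROVED STEP: one doubling of the level costs an additive
  `16 δ`, `FingerInv ε δ m → FingerInv (ε + 16 δ) δ (2m + 1)` (dyadic Bernoulli thinning of the relay set,
  `stub_dyadicThinning` of the sibling crux 4574, fed with the single-finger lemma); `fingerInv_three` —
  base `m ≤ 3` (so `m ≤ 2`) with constant `17`.
* `fingerInv_log` — the resulting a-priori envelope `FingerInv (16 δ ⌈log₂(m+1)⌉) δ m` (Theorem D,
  `nhlt_logScaleLowerTail`): the loss FACTOR per doubling is `1 + 1/j` at scale `j`, whose product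
  diverges like the number of scales — this logarithm is the whole distance to the crux.
* `fingerInv_pow_of_doublingStep`, `fingerInv_all_of_doublingStep` — the BOOKKEEPING of the conjectural
  step: if one doubling costs only a factor `1 + ℓ j` on `ε` and `1/(1 + ℓ j)` on `δ` with `∑ ℓ j < ∞`
  (convergent loss product), then `∀ ε > 0 ∃ δ > 0 ∀ m, FingerInv ε δ m` (`δ = ε · exp(−2 ∑ ℓ)`).
* `noHeavyLowerTail_of_fingerInv_all` — all levels ⇒ the crux, through the landed reduction
  `noHeavyLowerTail_of_manyFingersLargePocket` (the residual event has `1 ≤ N'`).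
* `noHeavyLowerTail_of_fingerDoublingStep` — the line's composition: summable doubling step ⇒ crux.
* `fingerInv_all_of_nearOneGluing` — conversely the crux (≡ `NearOneGluing`) gives all levels, so the
  line's target `∀ ε ∃ δ ∀ m, FingerInv ε δ m` is EQUIVALENT to the crux; and
  `fingerInv_of_additiveGluing` — the sibling crux `AdditiveGluing` (item 4576) gives every level with
  `ε = δ` (loss `ℓ ≡ 0`), so the conjectural step is implied by 4576 and is not a new strengthening.
-/

noncomputable section

namespace Summit.CriticalPhenomena.PercolationContinuityZ3.Theorems

open scoped Classical BigOperators Topology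
open MeasureTheory Set Filter
open Literature.Probability.LatticeModels (prodBernoulli)
open Literature.Probability.Percolation (openConn openConnIn BondConfig measurableSet_openConn_holds)
open Summit.CriticalPhenomena.PercolationContinuityZ3.Theses.PercNearOneGluing (NoHeavyLowerTail
  NearOneGluing AdditiveGluing)

/-! ### Base and the proved (logarithmic) step -/

/-- **Base `m = 1`, loss-free**: `FingerInv δ δ 1` — exactly one finger cut from the hub costs at most
the star budget, with no factor `|A|` (single-finger lemma `nhlt_singleFingerHub` on `T = A ∖ a₀`;
the observer budget is not used). [cite: KozmaNitzan2024, Lemma 2] -/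
theorem fingerInv_one {δ : ℝ} (hδ : 0 ≤ δ) : FingerInv δ δ 1 := by
  intro n w A o a₀ _ _ hstar _
  have h := nhlt_singleFingerHub n w (A.erase a₀) o a₀ δ hδ
    (fun a ha => hstar a (Finset.mem_of_mem_erase ha))
  refine le_trans (measureReal_mono ?_) h
  rintro ω ⟨h1, h2, h3⟩
  exact ⟨le_antisymm h3 h2, h1⟩

/-- **Thinning window** (hub form of `stub_dyadicThinning` fed with the single-finger lemma): for
`1 ≤ K`, `P(o ↮ a₀, K ≤ N' < K·2^L) ≤ 16 L δ` under the star budget alone. [this work] -/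
theorem fingerInv_window (n : ℕ) (w : Sym2 (Fin n) → unitInterval) (A : Finset (Fin n))
    (o a₀ : Fin n) {δ : ℝ} (K L : ℕ) (hδ : 0 ≤ δ) (hK : 1 ≤ K)
    (hstar : ∀ a ∈ A, (prodBernoulli w).real (openConn a a₀)ᶜ ≤ δ) :
    (prodBernoulli w).real {ω : BondConfig (Fin n) | ω ∉ openConn o a₀ ∧
        K ≤ ((A.erase a₀).filter fun a => ω ∈ openConn o a).card ∧
        ((A.erase a₀).filter fun a => ω ∈ openConn o a).card < K * 2 ^ L} ≤ 16 * (L : ℝ) * δ :=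
  stub_dyadicThinning nhlt_singleFingerHub n w (A.erase a₀) o a₀ δ K L hδ hK
    (fun a ha => hstar a (Finset.mem_of_mem_erase ha))

/-- **The proved step (one doubling costs `16 δ`)**: `FingerInv ε δ m → FingerInv (ε + 16 δ) δ (2m+1)`
— the levels `m+1 … 2m+1` form one thinning window `[m+1, 2(m+1))`. [this work] -/
theorem fingerInv_double {ε δ : ℝ} {m : ℕ} (hδ : 0 ≤ δ) (h : FingerInv ε δ m) :
    FingerInv (ε + 16 * δ) δ (2 * m + 1) := by
  intro n w A o a₀ ha₀ ho hstar hobs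
  have h1 := h n w A o a₀ ha₀ ho hstar hobs
  have h2 := fingerInv_window n w A o a₀ (m + 1) 1 hδ (by omega) hstar
  have hcover : {ω : BondConfig (Fin n) | ω ∉ openConn o a₀ ∧
      1 ≤ ((A.erase a₀).filter fun a => ω ∈ openConn o a).card ∧
      ((A.erase a₀).filter fun a => ω ∈ openConn o a).card ≤ 2 * m + 1} ⊆
      {ω : BondConfig (Fin n) | ω ∉ openConn o a₀ ∧
        1 ≤ ((A.erase a₀).filter fun a => ω ∈ openConn o a).card ∧
        ((A.erase a₀).filter fun a => ω ∈ openConn o a).card ≤ m} ∪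
      {ω : BondConfig (Fin n) | ω ∉ openConn o a₀ ∧
        m + 1 ≤ ((A.erase a₀).filter fun a => ω ∈ openConn o a).card ∧
        ((A.erase a₀).filter fun a => ω ∈ openConn o a).card < (m + 1) * 2 ^ 1} := by
    rintro ω ⟨hb, hlo, hhi⟩
    by_cases hm : ((A.erase a₀).filter fun a => ω ∈ openConn o a).card ≤ m
    · exact Or.inl ⟨hb, hlo, hm⟩
    · refine Or.inr ⟨hb, by omega, ?_⟩
      have : (m + 1) * 2 ^ 1 = 2 * m + 2 := by ring
      omega
  calc (prodBernoulli w).real {ω : BondConfig (Fin n) | ω ∉ openConn o a₀ ∧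
        1 ≤ ((A.erase a₀).filter fun a => ω ∈ openConn o a).card ∧
        ((A.erase a₀).filter fun a => ω ∈ openConn o a).card ≤ 2 * m + 1}
      ≤ (prodBernoulli w).real ({ω : BondConfig (Fin n) | ω ∉ openConn o a₀ ∧
          1 ≤ ((A.erase a₀).filter fun a => ω ∈ openConn o a).card ∧
          ((A.erase a₀).filter fun a => ω ∈ openConn o a).card ≤ m} ∪
        {ω : BondConfig (Fin n) | ω ∉ openConn o a₀ ∧
          m + 1 ≤ ((A.erase a₀).filter fun a => ω ∈ openConn o a).card ∧
          ((A.erase a₀).filter fun a => ω ∈ openConn o a).card < (m + 1) * 2 ^ 1}) :=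
        measureReal_mono hcover
    _ ≤ _ := measureReal_union_le _ _
    _ ≤ ε + 16 * δ := by
        have : (16 : ℝ) * ((1 : ℕ) : ℝ) * δ = 16 * δ := by norm_num
        linarith [h1, h2]

/-- **Base `m ≤ 3` (hence `m ≤ 2`)**: `FingerInv (17 δ) δ 3` — the loss-free level `1` plus one thinning
window `[2, 4)`. [this work] -/
theorem fingerInv_three {δ : ℝ} (hδ : 0 ≤ δ) : FingerInv (17 * δ) δ 3 := by
  have h := fingerInv_double hδ (fingerInv_one hδ)
  have h17 : δ + 16 * δ = 17 * δ := by ring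
  rw [h17] at h
  exact h

/-- **The a-priori logarithmic envelope** (Theorem D, `nhlt_logScaleLowerTail`, in the language of the
invariant): `FingerInv (16 δ ⌈log₂ (m+1)⌉) δ m` for every `m` — the union of the dyadic windows below
`m + 1`; equivalently the proved doubling step iterated, loss factor `1 + 1/j` at scale `j`. [this work] -/
theorem fingerInv_log {δ : ℝ} (m : ℕ) : FingerInv (16 * δ * (Nat.clog 2 (m + 1) : ℝ)) δ m := by
  intro n w A o a₀ ha₀ _ hstar _
  have h := nhlt_logScaleLowerTail n w A o a₀ δ (m + 1) ha₀ hstar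
  refine le_trans (measureReal_mono ?_) h
  rintro ω ⟨h1, h2, h3⟩
  exact ⟨h1, h2, Nat.lt_succ_of_le h3⟩

/-! ### Bookkeeping of the conjectural step: a convergent loss product reaches every level -/

/-- `1 ≤ ∏_{i<j} (1 + ℓ i)` for a non-negative loss sequence. [this work] -/
theorem one_le_prod_one_add (ℓ : ℕ → ℝ) (hℓ0 : ∀ j, 0 ≤ ℓ j) (j : ℕ) :
    1 ≤ ∏ i ∈ Finset.range j, (1 + ℓ i) := by
  calc (1 : ℝ) = ∏ _i ∈ Finset.range j, (1 : ℝ) := by simp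
    _ ≤ ∏ i ∈ Finset.range j, (1 + ℓ i) :=
        Finset.prod_le_prod (fun _ _ => zero_le_one) (fun i _ => by linarith [hℓ0 i])

/-- `∏_{i<j} (1 + ℓ i) ≤ exp (∑' ℓ)` for a non-negative summable loss sequence: the loss product
converges. [this work] -/
theorem prod_one_add_le_exp_tsum (ℓ : ℕ → ℝ) (hℓ0 : ∀ j, 0 ≤ ℓ j) (hℓ : Summable ℓ) (j : ℕ) :
    ∏ i ∈ Finset.range j, (1 + ℓ i) ≤ Real.exp (∑' i, ℓ i) := by
  calc ∏ i ∈ Finset.range j, (1 + ℓ i) ≤ ∏ i ∈ Finset.range j, Real.exp (ℓ i) :=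
        Finset.prod_le_prod (fun i _ => by linarith [hℓ0 i])
          (fun i _ => by linarith [Real.add_one_le_exp (ℓ i)])
    _ = Real.exp (∑ i ∈ Finset.range j, ℓ i) := (Real.exp_sum _ _).symm
    _ ≤ Real.exp (∑' i, ℓ i) :=
        Real.exp_le_exp.2 (hℓ.sum_le_tsum (Finset.range j) (fun i _ => hℓ0 i))

/-- **Iterating the doubling step**: from the loss-free base `FingerInv δ₀ δ₀ 1` the step reaches the
dyadic level `2^j` with tolerance `δ₀ · P_j` and budget `δ₀ / P_j`, `P_j = ∏_{i<j} (1 + ℓ i)`.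
[this work] -/
theorem fingerInv_pow_of_doublingStep (ℓ : ℕ → ℝ) (hℓ0 : ∀ j, 0 ≤ ℓ j)
    (hstep : ∀ (ε δ : ℝ) (j : ℕ), 0 < δ → δ ≤ ε → FingerInv ε δ (2 ^ j) →
      FingerInv (ε * (1 + ℓ j)) (δ / (1 + ℓ j)) (2 ^ (j + 1)))
    {δ₀ : ℝ} (hδ₀ : 0 < δ₀) (j : ℕ) :
    FingerInv (δ₀ * ∏ i ∈ Finset.range j, (1 + ℓ i)) (δ₀ / ∏ i ∈ Finset.range j, (1 + ℓ i))
      (2 ^ j) := by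
  induction j with
  | zero => simpa using fingerInv_one hδ₀.le
  | succ j ih =>
    have hP : 1 ≤ ∏ i ∈ Finset.range j, (1 + ℓ i) := one_le_prod_one_add ℓ hℓ0 j
    have hP0 : 0 < ∏ i ∈ Finset.range j, (1 + ℓ i) := lt_of_lt_of_le one_pos hP
    have hδpos : 0 < δ₀ / ∏ i ∈ Finset.range j, (1 + ℓ i) := div_pos hδ₀ hP0
    have hδε : δ₀ / ∏ i ∈ Finset.range j, (1 + ℓ i) ≤ δ₀ * ∏ i ∈ Finset.range j, (1 + ℓ i) :=
      calc δ₀ / ∏ i ∈ Finset.range j, (1 + ℓ i) ≤ δ₀ / 1 :=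
            div_le_div_of_nonneg_left hδ₀.le one_pos hP
        _ = δ₀ * 1 := by ring
        _ ≤ δ₀ * ∏ i ∈ Finset.range j, (1 + ℓ i) := mul_le_mul_of_nonneg_left hP hδ₀.le
    have h := hstep _ _ j hδpos hδε ih
    have hℓj : 0 < 1 + ℓ j := by linarith [hℓ0 j]
    rw [Finset.prod_range_succ, ← mul_assoc, div_mul_eq_div_div]
    exact h

/-- **A convergent loss product reaches every level**: if the doubling step holds with a non-negative
summable loss sequence `ℓ`, then `∀ ε > 0 ∃ δ > 0 ∀ m, FingerInv ε δ m`, with the explicit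
`δ = ε · exp(−∑ ℓ)²`. [this work] -/
theorem fingerInv_all_of_doublingStep (ℓ : ℕ → ℝ) (hℓ0 : ∀ j, 0 ≤ ℓ j) (hℓ : Summable ℓ)
    (hstep : ∀ (ε δ : ℝ) (j : ℕ), 0 < δ → δ ≤ ε → FingerInv ε δ (2 ^ j) →
      FingerInv (ε * (1 + ℓ j)) (δ / (1 + ℓ j)) (2 ^ (j + 1))) :
    ∀ ε : ℝ, 0 < ε → ∃ δ : ℝ, 0 < δ ∧ ∀ m : ℕ, FingerInv ε δ m := by
  intro ε hε
  set M : ℝ := Real.exp (∑' i, ℓ i) with hM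
  have hM0 : 0 < M := Real.exp_pos _
  refine ⟨ε / M / M, by positivity, fun m => ?_⟩
  -- reach the dyadic level `2^m ≥ m` from `δ₀ = ε / M`
  have h := fingerInv_pow_of_doublingStep ℓ hℓ0 hstep (div_pos hε hM0) m
  have hP : 1 ≤ ∏ i ∈ Finset.range m, (1 + ℓ i) := one_le_prod_one_add ℓ hℓ0 m
  have hP0 : 0 < ∏ i ∈ Finset.range m, (1 + ℓ i) := lt_of_lt_of_le one_pos hP
  have hPM : ∏ i ∈ Finset.range m, (1 + ℓ i) ≤ M := prod_one_add_le_exp_tsum ℓ hℓ0 hℓ m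
  refine fingerInv_mono ?_ ?_ (Nat.lt_two_pow_self).le h
  · calc ε / M * ∏ i ∈ Finset.range m, (1 + ℓ i) ≤ ε / M * M :=
          mul_le_mul_of_nonneg_left hPM (div_pos hε hM0).le
      _ = ε := by field_simp
  · exact div_le_div_of_nonneg_left (div_pos hε hM0).le hP0 hPM

/-! ### The two ends: all levels ⇔ the crux -/

/-- **All levels ⇒ the crux.** If `∀ ε > 0 ∃ δ > 0 ∀ m, FingerInv ε δ m`, then `NoHeavyLowerTail`:
the many-fingers residual of the landed reduction `noHeavyLowerTail_of_manyFingersLargePocket`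
(with `d₀ = 0`, `s₀ = 1`) is an event with `o ↮ a₀` and `1 ≤ N' ≤ |A|`, i.e. inside level `|A|`;
pairwise reliability gives the star budget. [this work] -/
theorem noHeavyLowerTail_of_fingerInv_all
    (hall : ∀ ε : ℝ, 0 < ε → ∃ δ : ℝ, 0 < δ ∧ ∀ m : ℕ, FingerInv ε δ m) : NoHeavyLowerTail := by
  refine noHeavyLowerTail_of_manyFingersLargePocket fun ε hε => ?_
  obtain ⟨δ, hδ, hF⟩ := hall ε hε
  refine ⟨δ, 0, 1, hδ, fun n w A o a₀ ha₀ ho hpair hobs => ?_⟩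
  have hstar : ∀ a ∈ A, (prodBernoulli w).real (openConn a a₀)ᶜ ≤ δ :=
    fun a ha => hpair a ha a₀ ha₀
  refine le_trans (measureReal_mono ?_) (hF A.card n w A o a₀ ha₀ ho hstar hobs)
  rintro ω ⟨h1, h2, _, _⟩
  exact ⟨h1, h2, le_trans (Finset.card_filter_le _ _) (Finset.card_erase_le)⟩

/-- **The composition of the line `finger-induction`**: the conjectural SUMMABLE DOUBLING STEP — one
doubling of the finger level costs a factor `1 + ℓ j` on the tolerance and `1/(1 + ℓ j)` on the budget,
with `∑ ℓ j < ∞` — implies the crux `NoHeavyLowerTail` (base `fingerInv_one`, bookkeeping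
`fingerInv_all_of_doublingStep`, transfer `noHeavyLowerTail_of_fingerInv_all`). [this work] -/
theorem noHeavyLowerTail_of_fingerDoublingStep
    (hstep : ∃ ℓ : ℕ → ℝ, (∀ j, 0 ≤ ℓ j) ∧ Summable ℓ ∧
      ∀ (ε δ : ℝ) (j : ℕ), 0 < δ → δ ≤ ε → FingerInv ε δ (2 ^ j) →
        FingerInv (ε * (1 + ℓ j)) (δ / (1 + ℓ j)) (2 ^ (j + 1))) :
    NoHeavyLowerTail := by
  obtain ⟨ℓ, hℓ0, hℓ, h⟩ := hstep
  exact noHeavyLowerTail_of_fingerInv_all (fingerInv_all_of_doublingStep ℓ hℓ0 hℓ h)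

/-- Complements have real mass `1 − P(·)` under the (probability) percolation measure. [folklore] -/
theorem fingerInv_real_compl {n : ℕ} (w : Sym2 (Fin n) → unitInterval)
    {s : Set (BondConfig (Fin n))} (hs : MeasurableSet s) :
    (prodBernoulli w).real sᶜ = 1 - (prodBernoulli w).real s := by
  rw [measureReal_compl hs, probReal_univ]

/-- **The crux ⇒ all levels** (so the line's target is EQUIVALENT to the crux): `NearOneGluing`
(≡ `NoHeavyLowerTail`, items 4577/14716 and the Disproof's `iff_nearOneGluing`) applied with `b := a₀`
bounds `P(o ↮ a₀)`, which contains every level. [this work] -/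
theorem fingerInv_all_of_nearOneGluing (hX : NearOneGluing) :
    ∀ ε : ℝ, 0 < ε → ∃ δ : ℝ, 0 < δ ∧ ∀ m : ℕ, FingerInv ε δ m := by
  intro ε hε
  obtain ⟨δ, hδ, hXδ⟩ := hX ε hε
  refine ⟨δ / 2, by positivity, fun m => ?_⟩
  intro n w A o a₀ _ _ hstar hobs
  have hU : MeasurableSet (⋃ a ∈ A, openConn o a : Set (BondConfig (Fin n))) :=
    Finset.measurableSet_biUnion A fun a _ => measurableSet_openConn_holds o a
  have h1 : 1 - δ < (prodBernoulli w).real (⋃ a ∈ A, openConn o a) := by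
    have := fingerInv_real_compl w hU
    linarith
  have h2 : ∀ a ∈ A, 1 - δ < (prodBernoulli w).real (openConn a a₀) := by
    intro a ha
    have := fingerInv_real_compl w (measurableSet_openConn_holds a a₀)
    linarith [hstar a ha]
  have h3 := hXδ n w A o a₀ h1 h2
  calc (prodBernoulli w).real {ω : BondConfig (Fin n) | ω ∉ openConn o a₀ ∧
        1 ≤ ((A.erase a₀).filter fun a => ω ∈ openConn o a).card ∧
        ((A.erase a₀).filter fun a => ω ∈ openConn o a).card ≤ m}
      ≤ (prodBernoulli w).real (openConn o a₀)ᶜ := measureReal_mono fun ω h => h.1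
    _ = 1 - (prodBernoulli w).real (openConn o a₀) :=
        fingerInv_real_compl w (measurableSet_openConn_holds o a₀)
    _ ≤ ε := by linarith

/-- **`AdditiveGluing` (item 4576) ⇒ every level with `ε = δ`**: with `b := a₀ ∈ A` and slack `t = δ`,
`P(o ↔ A) − P(o ↔ a₀) ≤ δ`, and every level lies in `{o ↔ A} ∖ {o ↔ a₀}`.  Hence the conjectural step
holds with loss `ℓ ≡ 0` under 4576: it is not a strengthening beyond the route's own proxy. [this work] -/
theorem fingerInv_of_additiveGluing (hAG : AdditiveGluing) {ε δ : ℝ} (m : ℕ) (hδ : 0 ≤ δ)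
    (hδε : δ ≤ ε) : FingerInv ε δ m := by
  intro n w A o a₀ ha₀ _ hstar _
  have hA : ∀ a ∈ A, 1 - δ ≤ (prodBernoulli w).real (openConn a a₀) := by
    intro a ha
    have := fingerInv_real_compl w (measurableSet_openConn_holds a a₀)
    linarith [hstar a ha]
  have key := hAG n w A o a₀ δ hδ hA
  set U : Set (BondConfig (Fin n)) := ⋃ a ∈ A, openConn o a with hUdef
  set V : Set (BondConfig (Fin n)) := openConn o a₀ with hVdef
  have hVU : V ⊆ U := by
    rw [hUdef, hVdef]
    exact Set.subset_biUnion_of_mem (u := fun a => (openConn o a : Set (BondConfig (Fin n)))) ha₀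
  have hdiff : (prodBernoulli w).real (U \ V) = (prodBernoulli w).real U - (prodBernoulli w).real V := by
    have h := measureReal_add_sdiff (μ := prodBernoulli w) (t := U) (measurableSet_openConn_holds o a₀)
      (measure_ne_top _ _) (measure_ne_top _ _)
    rw [Set.union_eq_self_of_subset_left hVU] at h
    rw [hVdef]
    linarith
  have hsub : {ω : BondConfig (Fin n) | ω ∉ openConn o a₀ ∧
      1 ≤ ((A.erase a₀).filter fun a => ω ∈ openConn o a).card ∧
      ((A.erase a₀).filter fun a => ω ∈ openConn o a).card ≤ m} ⊆ U \ V := by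
    rintro ω ⟨hb, hlo, _⟩
    refine ⟨?_, hb⟩
    obtain ⟨a, ha⟩ := Finset.card_pos.1 hlo
    rw [Finset.mem_filter] at ha
    rw [hUdef]
    exact Set.mem_biUnion (Finset.mem_coe.2 (Finset.mem_of_mem_erase ha.1)) ha.2
  calc (prodBernoulli w).real {ω : BondConfig (Fin n) | ω ∉ openConn o a₀ ∧
        1 ≤ ((A.erase a₀).filter fun a => ω ∈ openConn o a).card ∧
        ((A.erase a₀).filter fun a => ω ∈ openConn o a).card ≤ m}
      ≤ (prodBernoulli w).real (U \ V) := measureReal_mono hsub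
    _ = (prodBernoulli w).real U - (prodBernoulli w).real V := hdiff
    _ ≤ δ := by rw [hVdef]; linarith
    _ ≤ ε := hδε

/-- **Registered form of the composition** (hypothesis = the registered stub `stub_fingerDoublingStep` of
crux stmt-CriticalPhenomena-4575 VERBATIM, i.e. with `FingerInv` unfolded): the summable doubling step
implies `NoHeavyLowerTail`.  Definitionally `noHeavyLowerTail_of_fingerDoublingStep`. [this work] -/
theorem noHeavyLowerTail_of_stub_fingerDoublingStep :
    (∃ ℓ : ℕ → ℝ, (∀ j, 0 ≤ ℓ j) ∧ Summable ℓ ∧ ∀ (ε δ : ℝ) (j : ℕ), 0 < δ → δ ≤ ε → (∀ (n : ℕ) (w : Sym2 (Fin n) → unitInterval) (A : Finset (Fin n)) (o a₀ : Fin n), a₀ ∈ A → o ∉ A → (∀ a ∈ A, (Literature.Probability.LatticeModels.prodBernoulli w).real (Literature.Probability.Percolation.openConn a a₀)ᶜ ≤ δ) → (Literature.Probability.LatticeModels.prodBernoulli w).real (⋃ a ∈ A, Literature.Probability.Percolation.openConn o a)ᶜ ≤ δ → (Literature.Probability.LatticeModels.prodBernoulli w).real {ω : Literature.Probability.Percolation.BondConfig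 (Fin n) | ω ∉ Literature.Probability.Percolation.openConn o a₀ ∧ 1 ≤ ((A.erase a₀).filter fun a => ω ∈ Literature.Probability.Percolation.openConn o a).card ∧ ((A.erase a₀).filter fun a => ω ∈ Literature.Probability.Percolation.openConn o a).card ≤ 2 ^ j} ≤ ε) → (∀ (n : ℕ) (w : Sym2 (Fin n) → unitInterval) (A : Finset (Fin n)) (o a₀ : Fin n), a₀ ∈ A → o ∉ A → (∀ a ∈ A, (Literature.Probability.LatticeModels.prodBernoulli w).real (Literature.Probability.Percolation.openConn a a₀)ᶜ ≤ δ / (1 + ℓ j)) → (Literature.Probability.LatticeModels.prodBernoulli w).real (⋃ a ∈ A, Literature.Probability.Percolation.openConn o a)ᶜ ≤ δ / (1 + ℓ j) → (Literature.Probability.LatticeModels.prodBernoulli w).real {ω : Literature.Probability.Percolation.BondConfig (Fin n) | ω ∉ Literature.Probability.Percolation.openConn o a₀ ∧ 1 ≤ ((A.erase a₀).filter fun a => ω ∈ Literature.Probability.Percolation.openConn o a).card ∧ ((A.erase a₀).filter fun a => ω ∈ Literature.Probability.Percolation.openConn o a).card ≤ 2 ^ (j + 1)} ≤ ε * (1 +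 ℓ j))) →
      Summit.CriticalPhenomena.PercolationContinuityZ3.Theses.PercNearOneGluing.NoHeavyLowerTail :=
  fun hstep => noHeavyLowerTail_of_fingerDoublingStep hstep

end Summit.CriticalPhenomena.PercolationContinuityZ3.Theorems

end
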